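import Mathlib
import Literature.NumberTheory.LFunctions.Zhang2022.TypedAppendixB
import Literature.Analysis.Complex.VerticalLineShift
import Literature.NumberTheory.LFunctions.ZetaClassicalRegionBounds
import Literature.Analysis.SpecialFunctions.InvSqAddSqIntegral

/-!
# Zhang (2022) Appendix B, proof of Lemma 15.1: the Perron integrand
# `ζ(1+s)/ζ(1+s−β_j)·(P_μ/l₁)ˢ/((log P_μ)(s−β)²)` on vertical lines `Re s = σ > 0` —
# absolute integrability and the pole-free shift `Re s = 1 → Re s = ε`, GENERIC in `(P_μ, β)`

Topic `Literature/NumberTheory/LFunctions/Zhang2022` (Landau–Siegel audit tree; verdict-neutral).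
Y. Zhang, *Discrete mean estimates and the Landau–Siegel zero*, arXiv:2211.02515v1 (2022)
[Zhang2022LandauSiegel] — **an unrefereed manuscript under adjudication; nothing in this file asserts
any claim of the manuscript.** ZHANG-L discharge lane (WP15, App. B legs B1/B3/B4 under leaf
`Typed.Section15C.Eq15_22` / Lemma 15.1 χR; H-02 Part II cut (P2a)), DAG node `Z22:§B.u009` (text
after the display) [Z22 p.107, tex L5298]: "In a way similar to the proof of Lemma 8.1, we see that the
right side is equal to the sum of the residues of the integrand at `s = 0` and `s = β₇` plus an
acceptable error" — the first move of that contour argument, for the generic Perron integrand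
`F(s) = zetaRatio c′ D j s · kerB P_μ β l₁ s` of `TypedAppendixB` (`(P_μ, β) = (P₂, β₇), (P₃, β₆), (P₁, β₆)`
for `μ = 2, 3, 1`).

PROVED (theorems only; crude UNIFORM bounds — no zero-free region is needed on `Re s > 0`):

* `norm_zetaRatio_kerB_line_le` — on `Re s = σ > 0`:
  `‖F(σ+it)‖ ≤ (1 + 1/σ)²·(P_μ/l₁)^σ/((log P_μ)(σ² + (t − Im β)²))`, from `‖ζ(w)‖, ‖ζ(w)⁻¹‖ ≤ Re w/(Re w − 1)`
  for `Re w > 1` (`ZetaClassicalRegion.norm_riemannZeta_le_of_one_lt_re`, `norm_inv_riemannZeta_le_of_one_lt_re`;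
  `Re β_j = 0`, `Typed.AppendixB.betaJ_re`) and `‖xˢ‖ = x^σ`;
* `differentiableAt_zetaRatio_kerB` — `F` is complex differentiable at every `s` with `Re s > 0`
  (`ζ(1+s)`, `ζ(1+s−β_j)` off their pole, `ζ(1+s−β_j) ≠ 0` on `Re > 1`, `(s − β)² ≠ 0`);
* `integrable_zetaRatio_kerB_line` — `t ↦ F(σ+it)` is integrable for every `σ > 0` (majorant
  `C/(σ² + (t − Im β)²)`);
* `vline_shift_zetaRatio_kerB` — for `0 < ε ≤ 1`, `∫ F(1+it) dt = ∫ F(ε+it) dt` (the strip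
  `ε ≤ Re s ≤ 1` is pole-free; Cauchy–Goursat with decay `O(1/T²)` on the horizontal segments,
  `Literature.Analysis.Complex.integral_vertical_eq_of_differentiableOn`).

These are the inputs (P2a) of the generic line-to-circle bound `vline_zetaRatio_kerB_sub_circle_le`
(`AppendixBLineToCircleGeneric`, zl-libA-p6). WHAT THIS IS NOT: the residues, the tail/side estimates,
Lemma 15.1, or any claim about Theorems 1–2 / Landau–Siegel zeros.

## References

* Y. Zhang, arXiv:2211.02515v1 (2022), App. B p. 107. [cite: Zhang2022LandauSiegel, App. B p.107]
* H. L. Montgomery, R. C. Vaughan, *Multiplicative Number Theory I*, CUP 2007, §5.1 (5.21)–(5.22)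
  (Perron lines and their shifts). [cite: MontgomeryVaughan2007, §5.1]
-/

noncomputable section

open Complex Real Set MeasureTheory Filter Topology

namespace Literature.NumberTheory.LFunctions.Zhang2022.Typed.AppendixB

open Literature.NumberTheory.LFunctions.Zhang2022.Skeleton
open Literature.NumberTheory.LFunctions.ZetaClassicalRegion
  (norm_riemannZeta_le_of_one_lt_re norm_inv_riemannZeta_le_of_one_lt_re)
open Literature.Analysis.SpecialFunctions (integrable_inv_sq_add_sq_of_ne_zero)

section LineShift

variable (c' : ℝ)

/-- Real and imaginary parts of a point `σ + it − β` of the line `Re s = σ` shifted by a purely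
imaginary `β`. [folklore] -/
private theorem line_sub_re_im {β : ℂ} (hβ : β.re = 0) (σ t : ℝ) :
    ((((σ : ℝ) : ℂ) + (t : ℂ) * I) - β).re = σ ∧ ((((σ : ℝ) : ℂ) + (t : ℂ) * I) - β).im = t - β.im := by
  constructor
  · simp [hβ]
  · simp

/-- `‖(σ + it − β)²‖ = σ² + (t − Im β)²` for purely imaginary `β`. [folklore] -/
private theorem norm_line_sub_sq {β : ℂ} (hβ : β.re = 0) (σ t : ℝ) :
    ‖((((σ : ℝ) : ℂ) + (t : ℂ) * I) - β) ^ 2‖ = σ ^ 2 + (t - β.im) ^ 2 := by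
  obtain ⟨hre, him⟩ := line_sub_re_im hβ σ t
  rw [norm_pow, Complex.sq_norm, Complex.normSq_apply, hre, him]
  ring

/-- **Pointwise bound on the line `Re s = σ > 0`** for the generic App. B Perron integrand:
`‖ζ(1+s)/ζ(1+s−β_j)·(P_μ/l₁)ˢ/((log P_μ)(s−β)²)‖ ≤ (1 + 1/σ)²·(P_μ/l₁)^σ/((log P_μ)(σ² + (t − Im β)²))`
(`P_μ > 1`, `l₁ ≥ 1`, `Re β = 0`). [cite: Zhang2022LandauSiegel, App. B p.107] -/
theorem norm_zetaRatio_kerB_line_le {D j : ℕ} {Pμ : ℝ} {l₁ : ℕ} {β : ℂ} {σ : ℝ} (hPμ : 1 < Pμ)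
    (hl₁ : 1 ≤ l₁) (hβ : β.re = 0) (hσ : 0 < σ) (t : ℝ) :
    ‖zetaRatio c' D j (((σ : ℝ) : ℂ) + (t : ℂ) * I) * kerB Pμ β l₁ (((σ : ℝ) : ℂ) + (t : ℂ) * I)‖ ≤
      (1 + 1 / σ) ^ 2 * (Pμ / l₁) ^ σ / (Real.log Pμ * (σ ^ 2 + (t - β.im) ^ 2)) := by
  have hx : 0 < Pμ / l₁ := div_pos (by linarith) (by exact_mod_cast hl₁)
  have hL : 0 < Real.log Pμ := Real.log_pos hPμ
  have hσ0 : σ ≠ 0 := hσ.ne'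
  have hden : 0 < σ ^ 2 + (t - β.im) ^ 2 := add_pos_of_pos_of_nonneg (pow_pos hσ 2) (sq_nonneg _)
  have hquot : (1 + σ) / (1 + σ - 1) = 1 + 1 / σ := by
    rw [show (1 : ℝ) + σ - 1 = σ by ring]; field_simp; ring
  -- the two `ζ`-factors
  have h1re : ((1 : ℂ) + ((((σ : ℝ) : ℂ) + (t : ℂ) * I))).re = 1 + σ := by simp
  have h2re : ((1 : ℂ) + ((((σ : ℝ) : ℂ) + (t : ℂ) * I)) - betaJ c' D j).re = 1 + σ := by
    simp [betaJ_re]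
  have hζ1 : ‖riemannZeta (1 + ((((σ : ℝ) : ℂ) + (t : ℂ) * I)))‖ ≤ 1 + 1 / σ := by
    have h := norm_riemannZeta_le_of_one_lt_re (s := 1 + ((((σ : ℝ) : ℂ) + (t : ℂ) * I)))
      (by rw [h1re]; linarith)
    rw [h1re, hquot] at h
    exact h
  have hζ2 : ‖(riemannZeta (1 + ((((σ : ℝ) : ℂ) + (t : ℂ) * I)) - betaJ c' D j))⁻¹‖ ≤ 1 + 1 / σ := by
    have h := norm_inv_riemannZeta_le_of_one_lt_re
      (s := 1 + ((((σ : ℝ) : ℂ) + (t : ℂ) * I)) - betaJ c' D j) (by rw [h2re]; linarith)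
    rw [h2re, hquot] at h
    exact h
  have hzr : ‖zetaRatio c' D j (((σ : ℝ) : ℂ) + (t : ℂ) * I)‖ ≤ (1 + 1 / σ) ^ 2 := by
    rw [zetaRatio, div_eq_mul_inv, norm_mul]
    calc _ ≤ (1 + 1 / σ) * (1 + 1 / σ) := mul_le_mul hζ1 hζ2 (norm_nonneg _) (by positivity)
      _ = (1 + 1 / σ) ^ 2 := by ring
  -- the kernel
  have hker : ‖kerB Pμ β l₁ (((σ : ℝ) : ℂ) + (t : ℂ) * I)‖ =
      (Pμ / l₁) ^ σ / (Real.log Pμ * (σ ^ 2 + (t - β.im) ^ 2)) := by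
    rw [kerB, norm_div, norm_mul, Complex.norm_cpow_eq_rpow_re_of_pos hx, norm_line_sub_sq hβ,
      Complex.norm_real, Real.norm_eq_abs, abs_of_pos hL]
    simp
  rw [norm_mul, hker]
  have hk0 : 0 ≤ (Pμ / l₁) ^ σ / (Real.log Pμ * (σ ^ 2 + (t - β.im) ^ 2)) := by positivity
  calc _ ≤ (1 + 1 / σ) ^ 2 * ((Pμ / l₁) ^ σ / (Real.log Pμ * (σ ^ 2 + (t - β.im) ^ 2))) :=
        mul_le_mul_of_nonneg_right hzr hk0
    _ = _ := by ring

/-- **The generic integrand is complex differentiable on `Re s > 0`** (`ζ(1+s)` off its pole `s = 0`,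
`ζ(1+s−β_j)` off its pole `s = β_j` and non-zero on `Re(1+s−β_j) = 1 + Re s > 1`, `(s−β)² ≠ 0` since
`Re β = 0 < Re s`). [cite: Zhang2022LandauSiegel, App. B p.107] -/
theorem differentiableAt_zetaRatio_kerB {D j : ℕ} {Pμ : ℝ} {l₁ : ℕ} {β : ℂ} (hPμ : 1 < Pμ)
    (hl₁ : 1 ≤ l₁) (hβ : β.re = 0) {s : ℂ} (hs : 0 < s.re) :
    DifferentiableAt ℂ (fun s : ℂ => zetaRatio c' D j s * kerB Pμ β l₁ s) s := by
  have hx : 0 < Pμ / l₁ := div_pos (by linarith) (by exact_mod_cast hl₁)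
  have hx' : ((Pμ / l₁ : ℝ) : ℂ) ≠ 0 := by exact_mod_cast hx.ne'
  have hL : (Real.log Pμ : ℂ) ≠ 0 := by exact_mod_cast (Real.log_pos hPμ).ne'
  have h1ne : (1 : ℂ) + s ≠ 1 := by
    intro h; have := congrArg Complex.re h; simp at this; linarith
  have h2re : ((1 : ℂ) + s - betaJ c' D j).re = 1 + s.re := by simp [betaJ_re]
  have h2ne : (1 : ℂ) + s - betaJ c' D j ≠ 1 := by
    intro h; have := congrArg Complex.re h; rw [h2re] at this; simp at this; linarith
  have h2nz : riemannZeta (1 + s - betaJ c' D j) ≠ 0 :=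
    riemannZeta_ne_zero_of_one_lt_re (by rw [h2re]; linarith)
  have hsβ : s - β ≠ 0 := by
    intro h; have := congrArg Complex.re h; simp [hβ] at this; linarith
  have hzr : DifferentiableAt ℂ (zetaRatio c' D j) s := by
    have hzr_eq : zetaRatio c' D j = fun s => riemannZeta (1 + s) / riemannZeta (1 + s - betaJ c' D j) :=
      rfl
    rw [hzr_eq]
    refine DifferentiableAt.div ?_ ?_ h2nz
    · exact (differentiableAt_riemannZeta h1ne).comp s (differentiableAt_id.const_add _)
    · exact (differentiableAt_riemannZeta h2ne).comp s ((differentiableAt_id.const_add _).sub_const _)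
  have hker : DifferentiableAt ℂ (kerB Pμ β l₁) s := by
    have hk_eq : kerB Pμ β l₁ = fun s => ((Pμ / l₁ : ℝ) : ℂ) ^ s / ((Real.log Pμ : ℂ) * (s - β) ^ 2) :=
      rfl
    rw [hk_eq]
    refine DifferentiableAt.div ?_ ?_ (mul_ne_zero hL (pow_ne_zero 2 hsβ))
    · exact differentiableAt_id.const_cpow (Or.inl hx')
    · exact (differentiableAt_const _).mul ((differentiableAt_id.sub_const β).pow 2)
  exact hzr.mul hker

/-- **Absolute integrability on every line `Re s = σ > 0`** (cut (P2a), input (1) of the generic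
line-to-circle bound): `t ↦ ζ(1+s)/ζ(1+s−β_j)·(P_μ/l₁)ˢ/((log P_μ)(s−β)²)|_{s = σ+it}` is integrable —
continuous, with the integrable majorant `(1+1/σ)²(P_μ/l₁)^σ/log P_μ · (σ² + (t − Im β)²)⁻¹`.
[cite: Zhang2022LandauSiegel, App. B p.107] -/
theorem integrable_zetaRatio_kerB_line {D j : ℕ} {Pμ : ℝ} {l₁ : ℕ} {β : ℂ} {σ : ℝ} (hPμ : 1 < Pμ)
    (hl₁ : 1 ≤ l₁) (hβ : β.re = 0) (hσ : 0 < σ) :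
    MeasureTheory.Integrable (fun t : ℝ => zetaRatio c' D j (((σ : ℝ) : ℂ) + (t : ℂ) * Complex.I) *
      kerB Pμ β l₁ (((σ : ℝ) : ℂ) + (t : ℂ) * Complex.I)) := by
  have hx : 0 < Pμ / l₁ := div_pos (by linarith) (by exact_mod_cast hl₁)
  have hL : 0 < Real.log Pμ := Real.log_pos hPμ
  -- continuity along the line, from complex differentiability on `Re s > 0`
  have hline : Continuous fun t : ℝ => ((σ : ℝ) : ℂ) + (t : ℂ) * I := by fun_prop
  have hcont : Continuous (fun t : ℝ => zetaRatio c' D j (((σ : ℝ) : ℂ) + (t : ℂ) * I) *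
      kerB Pμ β l₁ (((σ : ℝ) : ℂ) + (t : ℂ) * I)) := by
    refine continuous_iff_continuousAt.mpr fun t => ?_
    have hs : 0 < ((((σ : ℝ) : ℂ) + (t : ℂ) * I)).re := by simp [hσ]
    have hFc : ContinuousAt (fun s : ℂ => zetaRatio c' D j s * kerB Pμ β l₁ s)
        (((σ : ℝ) : ℂ) + (t : ℂ) * I) :=
      (differentiableAt_zetaRatio_kerB c' hPμ hl₁ hβ hs).continuousAt
    show ContinuousAt ((fun s : ℂ => zetaRatio c' D j s * kerB Pμ β l₁ s) ∘
      (fun t : ℝ => ((σ : ℝ) : ℂ) + (t : ℂ) * I)) t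
    exact ContinuousAt.comp (f := fun t : ℝ => ((σ : ℝ) : ℂ) + (t : ℂ) * I) (x := t) hFc
      hline.continuousAt
  -- the majorant
  set M : ℝ := (1 + 1 / σ) ^ 2 * (Pμ / l₁) ^ σ / Real.log Pμ with hM
  have hmaj : Integrable fun t : ℝ => M * (σ ^ 2 + (t - β.im) ^ 2)⁻¹ :=
    ((integrable_inv_sq_add_sq_of_ne_zero hσ.ne').comp_sub_right β.im).const_mul M
  refine hmaj.mono' hcont.aestronglyMeasurable (Eventually.of_forall fun t => ?_)
  have hden : 0 < σ ^ 2 + (t - β.im) ^ 2 := by positivity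
  calc _ ≤ (1 + 1 / σ) ^ 2 * (Pμ / l₁) ^ σ / (Real.log Pμ * (σ ^ 2 + (t - β.im) ^ 2)) :=
        norm_zetaRatio_kerB_line_le c' hPμ hl₁ hβ hσ t
    _ = M * (σ ^ 2 + (t - β.im) ^ 2)⁻¹ := by rw [hM]; field_simp

/-- **The pole-free shift `Re s = 1 → Re s = ε`** (cut (P2a), input (2) of the generic line-to-circle
bound): for `0 < ε ≤ 1`,
`∫ ζ(1+s)/ζ(1+s−β_j)·(P_μ/l₁)ˢ/((log P_μ)(s−β)²)|_{s=1+it} dt = ∫ (same)|_{s=ε+it} dt` — the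
integrand is holomorphic on the closed strip `ε ≤ Re s ≤ 1` (its poles `0, β_j, β` lie on `Re s = 0`),
integrable on both boundary lines, and `O(1/T²)` on the horizontal segments `[ε,1] + iT` uniformly
(Cauchy–Goursat, `Literature.Analysis.Complex.integral_vertical_eq_of_differentiableOn`).
[cite: Zhang2022LandauSiegel, App. B p.107] -/
theorem vline_shift_zetaRatio_kerB {D j : ℕ} {Pμ : ℝ} {l₁ : ℕ} {β : ℂ} {ε : ℝ} (hPμ : 1 < Pμ)
    (hl₁ : 1 ≤ l₁) (hβ : β.re = 0) (hε : 0 < ε) (hε1 : ε ≤ 1) :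
    (∫ t : ℝ, zetaRatio c' D j (((1 : ℝ) : ℂ) + (t : ℂ) * Complex.I) *
        kerB Pμ β l₁ (((1 : ℝ) : ℂ) + (t : ℂ) * Complex.I)) =
      ∫ t : ℝ, zetaRatio c' D j (((ε : ℝ) : ℂ) + (t : ℂ) * Complex.I) *
        kerB Pμ β l₁ (((ε : ℝ) : ℂ) + (t : ℂ) * Complex.I) := by
  have hx : 0 < Pμ / l₁ := div_pos (by linarith) (by exact_mod_cast hl₁)
  have hL : 0 < Real.log Pμ := Real.log_pos hPμ
  -- holomorphy on the closed strip `ε ≤ Re s ≤ 1`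
  have hF : DifferentiableOn ℂ (fun s : ℂ => zetaRatio c' D j s * kerB Pμ β l₁ s)
      (re ⁻¹' Icc ε 1) := by
    intro s hs
    have hs' : ε ≤ s.re ∧ s.re ≤ 1 := hs
    exact (differentiableAt_zetaRatio_kerB c' hPμ hl₁ hβ (lt_of_lt_of_le hε hs'.1)).differentiableWithinAt
  -- integrability on the two boundary lines
  have ha := integrable_zetaRatio_kerB_line c' (D := D) (j := j) (β := β) hPμ hl₁ hβ hε
  have hb := integrable_zetaRatio_kerB_line c' (D := D) (j := j) (β := β) hPμ hl₁ hβ one_pos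
  -- uniform decay on the horizontal segments `[ε, 1] + iT`
  set B : ℝ := (1 + 1 / ε) ^ 2 * max (Pμ / l₁) 1 / Real.log Pμ with hB
  have hB0 : 0 ≤ B := by positivity
  have hbound : ∀ (u : ℝ), u ∈ Icc ε 1 → ∀ T : ℝ,
      ‖zetaRatio c' D j (((u : ℝ) : ℂ) + (T : ℂ) * I) * kerB Pμ β l₁ (((u : ℝ) : ℂ) + (T : ℂ) * I)‖ ≤
        B / (u ^ 2 + (T - β.im) ^ 2) := by
    intro u hu T
    have hu0 : 0 < u := lt_of_lt_of_le hε hu.1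
    have hden : 0 < u ^ 2 + (T - β.im) ^ 2 := add_pos_of_pos_of_nonneg (pow_pos hu0 2) (sq_nonneg _)
    refine (norm_zetaRatio_kerB_line_le c' hPμ hl₁ hβ hu0 T).trans ?_
    rw [← div_div, div_le_div_iff_of_pos_right hden, hB]
    -- `(1+1/u)² ≤ (1+1/ε)²` and `x^u ≤ max x 1` for `ε ≤ u ≤ 1`
    have h1 : (1 + 1 / u) ^ 2 ≤ (1 + 1 / ε) ^ 2 := by
      have : 1 / u ≤ 1 / ε := one_div_le_one_div_of_le hε hu.1
      have h0 : 0 ≤ 1 + 1 / u := by positivity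
      nlinarith
    have h2 : (Pμ / l₁) ^ u ≤ max (Pμ / l₁) 1 := by
      rcases le_or_gt 1 (Pμ / l₁) with hx1 | hx1
      · calc (Pμ / l₁) ^ u ≤ (Pμ / l₁) ^ (1 : ℝ) := Real.rpow_le_rpow_of_exponent_le hx1 hu.2
          _ = Pμ / l₁ := Real.rpow_one _
          _ ≤ max (Pμ / l₁) 1 := le_max_left _ _
      · exact (Real.rpow_le_one hx.le hx1.le hu0.le).trans (le_max_right _ _)
    have h3 : (1 + 1 / u) ^ 2 * (Pμ / l₁) ^ u ≤ (1 + 1 / ε) ^ 2 * max (Pμ / l₁) 1 :=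
      mul_le_mul h1 h2 (Real.rpow_nonneg hx.le _) (by positivity)
    exact div_le_div_of_nonneg_right h3 hL.le
  have hdecay : ∀ η : ℝ, 0 < η → ∃ T₀ : ℝ, ∀ T : ℝ, T₀ ≤ |T| → ∀ u ∈ Icc ε 1,
      ‖(fun s : ℂ => zetaRatio c' D j s * kerB Pμ β l₁ s) (u + T * I)‖ ≤ η := by
    intro η hη
    -- `|T| ≥ |Im β| + R` with `R = √(B/η) + 1` gives `(T − Im β)² ≥ R² > B/η`
    set R : ℝ := Real.sqrt (B / η) + 1 with hR
    have hR0 : 0 < R := by positivity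
    have hRsq : B / η < R ^ 2 := by
      have hs := Real.sq_sqrt (show 0 ≤ B / η by positivity)
      nlinarith [Real.sqrt_nonneg (B / η)]
    refine ⟨|β.im| + R, fun T hT u hu => ?_⟩
    have hTc : R ≤ |T - β.im| := by
      have := abs_sub_abs_le_abs_sub T β.im
      linarith
    have hsq : R ^ 2 ≤ (T - β.im) ^ 2 := by
      rw [← sq_abs (T - β.im)]
      exact pow_le_pow_left₀ hR0.le hTc 2
    have hu0 : 0 < u := lt_of_lt_of_le hε hu.1
    have hden : 0 < u ^ 2 + (T - β.im) ^ 2 := add_pos_of_pos_of_nonneg (pow_pos hu0 2) (sq_nonneg _)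
    have hden' : B / η < u ^ 2 + (T - β.im) ^ 2 := by nlinarith [sq_nonneg u]
    calc ‖(fun s : ℂ => zetaRatio c' D j s * kerB Pμ β l₁ s) (u + T * I)‖
        ≤ B / (u ^ 2 + (T - β.im) ^ 2) := hbound u hu T
      _ ≤ η := by
          rw [div_le_iff₀ hden]
          have := (div_lt_iff₀ hη).1 hden'
          linarith
  have h := Literature.Analysis.Complex.integral_vertical_eq_of_differentiableOn hε1 hF ha hb hdecay
  exact h.symm

end LineShift

end Literature.NumberTheory.LFunctions.Zhang2022.Typed.AppendixB
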